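import Literature.Geometry.Kaehler.ComplexTorusChainIntegralPeriods
import Mathlib.MeasureTheory.Integral.Bochner.SumMeasure
import HarnessLib

/-!
# The class of a closed analytic subset of a complex torus is an integral Hodge class (all dimensions)

Layer `Literature/Geometry/Kaehler`; lane `lit-hodgefound`, Layer A4, row A4-18 (b) stage (ii)
(`run/shared/lean/pub/lit-hodgefound/SKELETON.md` §P Q58 / Q182).

`ComplexTorusChainIntegralPeriods.lean` proves the integrality of the periods `∫_Z η`,
`η ∈ H^{2d}(X, ℤ)`, of a closed analytic `Z ⊆ X = E/Λ` of POSITIVE pure dimension `d`. This file adds the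
(elementary) case of dimension `0` and assembles the unconditional statements for every `d`:

* `HolomorphicChain.finite_carrier_inter` — a holomorphic `0`-chain has finitely many carrier points in
  every compact set (Lelong's finiteness `𝓗⁰(reg|T| ∩ K) < ∞`, `𝓗⁰` counting points);
* `HolomorphicChain.exists_int_torusPeriod_eq_of_dim_zero` — its periods on `H⁰`-integral classes
  (constant `0`-forms with integer value) are integers: `∫_Z c = c · Σ_{x ∈ Z ∩ box} θ_T(x)`;
* **`ComplexTorus.exists_int_analyticCyclePeriod`**, **`ComplexTorus.analyticCycleClass_mem_integralHodgeClasses_unconditional`**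
  (+ `_mem_hodgeClasses_unconditional`) — for EVERY closed analytic `Z ⊆ X` of pure dimension `d` and
  codimension `p`, `∫_Z η ∈ ℤ` on `H^{2d}(X, ℤ)` and `[Z] ∈ H^{2p}(X, ℤ) ∩ H^{p,p}` (Voisin (2002),
  Prop. 11.20 with Thm. 11.21; Lange (2023), Lemma 6.2.7), with no hypothesis left.

Theorems only; no definition, no named fact.

## References

* [VoisinHodgeI2002] C. Voisin, *Hodge Theory and Complex Algebraic Geometry I*, CUP (2002), §11.1.2
  Cor. 11.15, Thm. 11.21, §11.1.3 Prop. 11.20.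
* [Lange2023AbelianVarietiesComplex] H. Lange, *Abelian Varieties over the Complex Numbers*, Springer
  (2023), §6.2.1 Lemma 6.2.7.
* [Harvey1977] R. Harvey, *Holomorphic chains and their boundaries*, PSPUM XXX.1 (1977), Lemma 1.3.
* [Federer1969] H. Federer, *Geometric Measure Theory*, Springer (1969), 2.10.2.
-/

noncomputable section

open scoped Manifold ENNReal NNReal Topology
open MeasureTheory TopologicalSpace Set Function Module Metric Filter
open Literature.Geometry.GeometricMeasureTheory

namespace Literature.Geometry.Kaehler

universe u

/-! ### Holomorphic `0`-chains: finitely many points in compact sets, integer periods -/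

namespace HolomorphicChain

section DimZero

variable {E : Type u} [NormedAddCommGroup E] [InnerProductSpace ℂ E] [FiniteDimensional ℂ E]
  [MeasurableSpace E] [BorelSpace E]

/-- `𝓗⁰` (Euclidean normalisation) of a finite set of points is its cardinality. [cite: Federer1969, 2.10.2] -/
theorem euclideanHausdorffMeasure_zero_finset (t : Finset E) :
    (μHE[0] : Measure E) (↑t : Set E) = t.card := by
  rw [Measure.euclideanHausdorffMeasure_zero, ← sum_measure_singleton]
  simp [Measure.hausdorffMeasure_zero_singleton]

/-- A set of finite `𝓗⁰`-measure is finite. [cite: Federer1969, 2.10.2] -/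
theorem finite_of_euclideanHausdorffMeasure_zero_lt_top {A : Set E} (hA : (μHE[0] : Measure E) A < ⊤) :
    A.Finite := by
  by_contra hinf
  set M : ℝ := ((μHE[0] : Measure E) A).toReal with hM
  obtain ⟨t, hts, htc⟩ := Set.Infinite.exists_subset_card_eq hinf (⌊M⌋₊ + 1)
  have h1 : ((μHE[0] : Measure E) (↑t : Set E)).toReal = t.card := by
    rw [euclideanHausdorffMeasure_zero_finset]; simp
  have h2 : ((μHE[0] : Measure E) (↑t : Set E)).toReal ≤ M :=
    ENNReal.toReal_mono hA.ne (measure_mono hts)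
  have h3 : M < ⌊M⌋₊ + 1 := Nat.lt_floor_add_one M
  rw [h1, htc] at h2
  push_cast at h2
  linarith

/-- **A holomorphic `0`-chain has finitely many carrier points in every compact set** (Lelong's
finiteness `𝓗⁰(reg|T| ∩ K) < ∞`). [cite: Harvey1977, Lemma 1.3] -/
theorem finite_carrier_inter (T : HolomorphicChain 𝓘(ℂ, E) (⊤ : Opens E) 0) {K : Set E} (hK : IsCompact K) :
    (T.carrier ∩ K).Finite :=
  finite_of_euclideanHausdorffMeasure_zero_lt_top (T.measure_carrier_inter_lt_top hK (subset_univ _))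

/-- **The total multiplicity of a `0`-chain in a relatively compact Borel window is an integer**:
`∫_D θ_T d(𝓗⁰ ⌞ reg|T|) = Σ_{x ∈ reg|T| ∩ D} θ_T(x) ∈ ℤ`. [cite: Harvey1977, Lemma 1.3] -/
theorem exists_int_setIntegral_density_of_dim_zero (T : HolomorphicChain 𝓘(ℂ, E) (⊤ : Opens E) 0)
    {K D : Set E} (hK : IsCompact K) (hD : MeasurableSet D) (hDK : D ⊆ K) :
    ∃ a : ℤ, ∫ x in D, (T.density x : ℝ) ∂((μHE[2 * 0] : Measure E).restrict T.carrier) = a := by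
  have hfin : (D ∩ T.carrier).Finite :=
    (T.finite_carrier_inter hK).subset fun x hx ↦ ⟨hx.2, hDK hx.1⟩
  refine ⟨∑ x ∈ hfin.toFinset, T.density x, ?_⟩
  have h1 : ((μHE[2 * 0] : Measure E).restrict T.carrier).restrict D =
      (μHE[0] : Measure E).restrict (↑hfin.toFinset : Set E) := by
    rw [Measure.restrict_restrict hD, hfin.coe_toFinset]
  have hone : ∀ x : E, (μHE[0] : Measure E) {x} = 1 := fun x ↦ by
    rw [Measure.euclideanHausdorffMeasure_zero, Measure.hausdorffMeasure_zero_singleton]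
  have hint : IntegrableOn (fun x ↦ (T.density x : ℝ)) (↑hfin.toFinset : Set E) (μHE[0] : Measure E) := by
    rw [← biUnion_of_singleton (↑hfin.toFinset : Set E)]
    exact (integrableOn_finite_biUnion hfin.toFinset.finite_toSet).2 fun x _ ↦
      integrableOn_singleton (by simp) (by rw [hone]; exact ENNReal.one_lt_top)
  change ∫ x, (T.density x : ℝ) ∂(((μHE[2 * 0] : Measure E).restrict T.carrier).restrict D) = _
  rw [h1, setIntegral_finset _ hint]
  simp [measureReal_def]

variable {ι : Type*} [Fintype ι] (Φ : (ι → ℝ) ≃L[ℝ] E)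

/-- **The periods of a holomorphic `0`-chain on `H⁰(X, ℤ)` are integers**: an integral `0`-form is a
constant integer `c`, and `∫_Z c = c · Σ_{x ∈ reg|T| ∩ Φ[0,1)^ι} θ_T(x)`. (No periodicity is needed.)
[cite: VoisinHodgeI2002, §11.1.2 Cor. 11.15] -/
theorem exists_int_torusPeriod_eq_of_dim_zero (T : HolomorphicChain 𝓘(ℂ, E) (⊤ : Opens E) 0)
    {η : E [⋀^Fin (2 * 0)]→L[ℝ] ℂ} (hη : η ∈ ComplexTorus.integralForms Φ (2 * 0)) :
    ∃ z : ℤ, T.torusPeriod Φ η = z := by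
  obtain ⟨z, hz⟩ := hη fun _ _ ↦ 0
  have hηc : ∀ v, η v = (z : ℂ) := fun v ↦ by
    rw [show v = ComplexTorus.latticeTuple Φ (fun _ _ ↦ (0 : ℤ)) from funext fun i ↦ Fin.elim0 i]
    exact hz
  obtain ⟨a, ha⟩ := T.exists_int_setIntegral_density_of_dim_zero (ComplexTorus.isCompact_closedPeriodBox Φ 0)
    (ComplexTorus.measurableSet_periodBox Φ 0) (ComplexTorus.periodBox_subset_closedPeriodBox Φ 0)
  refine ⟨a * z, ?_⟩
  rw [T.torusPeriod_apply Φ]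
  simp_rw [hηc]
  rw [integral_mul_const, integral_complex_ofReal, ha]
  push_cast
  ring

end DimZero

end HolomorphicChain

/-! ### Closed analytic subsets of dimension `0` of the torus -/

namespace ComplexTorus

variable {ι : Type*} [Fintype ι] {E : Type u} [NormedAddCommGroup E] [InnerProductSpace ℂ E]
  [FiniteDimensional ℂ E] [MeasurableSpace E] [BorelSpace E] (Φ : (ι → ℝ) ≃L[ℝ] E)

/-- `∫_Z η ∈ ℤ` on `H⁰(X, ℤ)` for a closed analytic `Z ⊆ X` of pure dimension `0` (a finite set of
points). [cite: VoisinHodgeI2002, §11.1.2 Cor. 11.15] -/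
theorem exists_int_analyticCyclePeriod_eq_of_dim_zero {Z : Set (ComplexTorus Φ)} (hZ : HasPureDim 𝓘(ℂ, E) Z 0)
    {η : E [⋀^Fin (2 * 0)]→L[ℝ] ℂ} (hη : η ∈ integralForms Φ (2 * 0)) :
    ∃ z : ℤ, analyticCyclePeriod Φ hZ η = z :=
  (analyticChain Φ hZ).exists_int_torusPeriod_eq_of_dim_zero Φ hη

variable [DecidableEq ι] {n : ℕ} (e : Fin n ≃ ι)

/-- The class of a closed analytic subset of pure dimension `0` is an integral Hodge class (of top degree).
[cite: VoisinHodgeI2002, §11.1.3 Prop. 11.20] -/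
theorem analyticCycleClass_mem_integralHodgeClasses_of_dim_zero {p : ℕ} (h : 2 * 0 + 2 * p = n)
    {Z : Set (ComplexTorus Φ)} (hZ : HasPureDim 𝓘(ℂ, E) Z 0) :
    analyticCycleClass Φ e h hZ ∈ integralHodgeClasses Φ p :=
  analyticCycleClass_mem_integralHodgeClasses Φ e h hZ fun _ hη ↦
    exists_int_analyticCyclePeriod_eq_of_dim_zero Φ hZ hη

/-! ### All dimensions -/

omit [DecidableEq ι] in
/-- **`∫_Z η ∈ ℤ` for every closed analytic `Z ⊆ X = E/Λ` of pure dimension `d` and every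
`η ∈ H^{2d}(X, ℤ) = integralForms Φ (2d)`** (Voisin (2002), §11.1.2: the fundamental class of an analytic
cycle is integral; dimension `0` by counting points, positive dimension by
`ComplexTorusChainIntegralPeriods.lean`). [cite: VoisinHodgeI2002, §11.1.2 Cor. 11.15 and Thm. 11.21] -/
theorem exists_int_analyticCyclePeriod : ∀ {d : ℕ} {Z : Set (ComplexTorus Φ)} (hZ : HasPureDim 𝓘(ℂ, E) Z d)
    {η : E [⋀^Fin (2 * d)]→L[ℝ] ℂ}, η ∈ integralForms Φ (2 * d) → ∃ z : ℤ, analyticCyclePeriod Φ hZ η = z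
  | 0, _, hZ, _, hη => exists_int_analyticCyclePeriod_eq_of_dim_zero Φ hZ hη
  | _ + 1, _, hZ, _, hη => exists_int_analyticCyclePeriod_eq Φ hZ hη

/-- **THE CLASS OF A CLOSED ANALYTIC SUBSET OF A COMPLEX TORUS IS AN INTEGRAL HODGE CLASS** — all
dimensions, no hypothesis left: for a closed analytic `Z ⊆ X = E/Λ` of pure dimension `d` and codimension
`p` (`2d + 2p = rk Λ`), `[Z] = (∫_Z ·)^♭ ∈ H^{2p}(X, ℤ) ∩ H^{p,p} = integralHodgeClasses Φ p` (Voisin (2002),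
Prop. 11.20: "the class of an analytic subvariety of codimension `p` is an integral class of type
`(p, p)`", with Thm. 11.21). [cite: VoisinHodgeI2002, §11.1.3 Prop. 11.20] -/
theorem analyticCycleClass_mem_integralHodgeClasses_unconditional {d p : ℕ} (h : 2 * d + 2 * p = n)
    {Z : Set (ComplexTorus Φ)} (hZ : HasPureDim 𝓘(ℂ, E) Z d) :
    analyticCycleClass Φ e h hZ ∈ integralHodgeClasses Φ p :=
  analyticCycleClass_mem_integralHodgeClasses Φ e h hZ fun _ hη ↦ exists_int_analyticCyclePeriod Φ hZ hη

/-- … and hence a Hodge class: **the classes of analytic cycles of a complex torus are Hodge classes**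
(Lange (2023), Lemma 6.2.7). [cite: Lange2023AbelianVarietiesComplex, §6.2.1 Lemma 6.2.7] -/
theorem analyticCycleClass_mem_hodgeClasses_unconditional {d p : ℕ} (h : 2 * d + 2 * p = n)
    {Z : Set (ComplexTorus Φ)} (hZ : HasPureDim 𝓘(ℂ, E) Z d) :
    analyticCycleClass Φ e h hZ ∈ hodgeClasses Φ p :=
  integralHodgeClasses_subset_hodgeClasses Φ p (analyticCycleClass_mem_integralHodgeClasses_unconditional Φ e h hZ)

end ComplexTorus

end Literature.Geometry.Kaehler
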